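import Summits.QuantumAdvantage.QuantumAdvantage.Theorems.WbwObfuscatedGluedTreesKowRiVocabulary

/-!
# Stub `stub_hcoeffCycle` — Patarin's coefficient-H bound on the bit-oracle game, along the atoms of the cycle datum
# (crux `WbwObfuscatedGluedTrees`, stmt-QuantumAdvantage-2340; line `knowledge-of-walk-split`, STAGE 6, real→ideal)

Registered stub of the stage-6 skeleton `Cruxes/WbwObfuscatedGluedTrees/Lines/knowledge_of_walk_split.lean` (target
`…KnowledgeOfWalkSplit.RealIdeal.IdealCodeSoundness`), held by the lead.  For a finite key space `Θ` rendered as cycle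
data by `cyc : Θ → CycleDatum d` (in stage 6: a pair of uniformly random `μ`-bit tables rendered as the generator's two
keyed Feistel permutations), suppose every PAIR OF CYLINDER EVENTS `Cyl L₁ σ.1 ∧ Cyl L₂ σ.2` with `|Lᵢ| ≤ 2t` is at least
`(1 − ε)` times as likely under `cyc θ`, `θ` uniform, as under a uniform cycle datum `σ`.  Then every `t`-round
bit-oracle walker (computationally unbounded transcript algorithm `M`, advice `x`, handed `x ++ name(ENTRANCE)`) succeeds
against `(cyc θ, ν)` with probability at most its success probability against `(σ, ν)` plus `ε`, for EVERY naming `ν`.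

Proof (all of it here): Patarin's two-world bound `OracleAlg.hcoeff_abs_le` (`HCoefficient.lean`) with NO bad transcripts.
Its ratio hypothesis asks, for every transcript `τ` arising against a uniform `σ₀`, that the event "the oracle of the key is
CONSISTENT with `τ`" be at least `(1 − ε)` times as likely in world `Θ` as in the uniform world.  By the LOCALITY of the
bit oracle (`stub_locality`, taken as a hypothesis: the answer to a query depends on `σ` only through the atom
`atomOf σ v` at the vertex `v` the query is about, and `atomOf σ v = α` is a shape condition plus two cylinder events with
`≤ 2` constraints each, `atomPairs`), consistency with `τ` is the event "the ATOM TUPLE of `σ` along the `≤ t` queries of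
`τ` lies in a fixed set of tuples" (`consistent_iff_goodTuple`); it is the disjoint union over those tuples `w` of the
fibres "atom tuple `= w`", each of which is empty in both worlds (shape mismatch) or a pair of cylinder events with
`≤ 2t` constraints each (`atomTuple_eq_iff`), where the hypothesis applies; summing the fibrewise inequalities
(`finProb_comp_eq_sum_filter`) gives the ratio hypothesis, and `hcoeff_abs_le` the claim (success is a property of the
answer transcript: `OracleAlg.run_eq_finish_answers`).
-/

set_option linter.dupNamespace false

noncomputable section

namespace Summit.QuantumAdvantage.QuantumAdvantage.Theorems.WbwObfuscatedGluedTrees.KnowledgeOfWalk.RealIdeal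

open Literature.Computability.Complexity Literature.Computability.QuantumComplexity
open Literature.Computability.QuantumComplexity.GluedTrees
open Literature.Computability.Cryptography Literature.Computability.Cryptography.ObfuscatedGluedTrees
open Summit.QuantumAdvantage.QuantumAdvantage.Theorems.WbwObfuscatedGluedTrees.KnowledgeOfWalk.BlackBox

variable {β : Type} {d N : ℕ}

/-! ## Probability helpers -/

/-- **Fibrewise decomposition over a filtered value set**: `Pr[P (g κ)] = Σ_{w : P w} Pr[g κ = w]`.
[cite: Patarin2009, App. B (p. 344, eq. (3))] -/
theorem finProb_comp_eq_sum_filter {Θ A : Type} [Fintype Θ] [Fintype A] [DecidableEq A]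
    (μ : PMF Θ) (g : Θ → A) (P : A → Prop) [DecidablePred P] :
    finProb μ (fun κ => P (g κ)) = ∑ w ∈ Finset.univ.filter P, finProb μ (fun κ => g κ = w) := by
  classical
  rw [finProb_eq_sum]
  have hr : ∀ w ∈ Finset.univ.filter P,
      finProb μ (fun κ => g κ = w) = ∑ κ, if g κ = w then (μ κ).toReal else 0 := fun w _ => finProb_eq_sum _ _
  rw [Finset.sum_congr rfl hr, Finset.sum_comm]
  refine Finset.sum_congr rfl fun κ _ => ?_
  rw [Finset.sum_filter]
  have h : ∀ w ∈ (Finset.univ : Finset A),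
      (if P w then (if g κ = w then (μ κ).toReal else 0) else 0) =
        (if g κ = w then (if P w then (μ κ).toReal else 0) else 0) := by
    intro w _
    split_ifs <;> rfl
  rw [Finset.sum_congr rfl h, Finset.sum_ite_eq]
  simp

/-- The probability of the empty event is `0`. [folklore] -/
theorem finProb_false {Θ : Type} [Fintype Θ] (μ : PMF Θ) : finProb μ (fun _ => False) = 0 := by
  rw [finProb_eq_sum]
  simp

/-! ## Transcripts: the query asked at each prefix, and consistency pointwise -/

/-- The query asked by `M` (input `x`) after the first `i` answers of the transcript `τ` (junk `[]` at an output step).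
[cite: Patarin2009, App. B (p. 343: "`Cᵢ` the value that `φ` choose when `φ` has obtained `σ₁, …, σᵢ₋₁`")] -/
def stepQuery (M : OracleAlg β) (x : List Bool) (τ : List (List Bool)) (i : ℕ) : List Bool :=
  match M.step x (τ.take i) with
  | Sum.inl q => q
  | Sum.inr _ => []

/-- At a query step, `stepQuery` is that query. [folklore] -/
theorem stepQuery_eq {M : OracleAlg β} {x : List Bool} {τ : List (List Bool)} {i : ℕ} {q : List Bool}
    (h : M.step x (τ.take i) = Sum.inl q) : stepQuery M x τ i = q := by
  simp [stepQuery, h]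

/-- **Consistency pointwise**: along a transcript all of whose proper prefixes ask queries, an oracle is consistent iff
it answers the `i`-th query by the `i`-th recorded answer, for every `i`. [cite: Patarin2009, §2 (definition of `H`)] -/
theorem consistent_iff_forall (M : OracleAlg β) (x : List Bool) (τ : List (List Bool)) (O : Oracle)
    (hq : ∀ i, i < τ.length → ∃ q, M.step x (τ.take i) = Sum.inl q) :
    M.Consistent x τ O ↔ ∀ i : Fin τ.length, τ[(i : ℕ)] = O (stepQuery M x τ i) := by
  constructor
  · intro h i
    obtain ⟨q, hq'⟩ := hq i i.isLt
    have h' := h i q i.isLt hq'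
    rw [stepQuery_eq hq', List.getElem?_eq_getElem i.isLt] at *
    exact Option.some.inj h'
  · intro h i q hi hstep
    have h' := h ⟨i, hi⟩
    rw [List.getElem?_eq_getElem hi]
    simp only at h'
    rw [h', stepQuery_eq hstep]

/-! ## Atom tuples along a transcript -/

section Atoms

variable (ν : NamingN d N) (M : OracleAlg β) (x : List Bool) (τ : List (List Bool))

/-- The vertex the `i`-th query of the transcript is about. [folklore] -/
def qVertex (i : ℕ) : Vertex d := queryVertex ν (stepQuery M x τ i)

/-- **The atom tuple of a cycle datum along a transcript**: the atoms at the vertices the queries are about. [folklore] -/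
def atomTuple (σ : CycleDatum d) : Fin τ.length → Atom d := fun i => atomOf σ (qVertex ν M x τ i)

/-- **The answer to the `i`-th query predicted by an atom tuple** (the σ-free oracle fed the tuple's atom at the vertex
the query is about, `none` elsewhere). [folklore] -/
def predicted (w : Fin τ.length → Atom d) (i : Fin τ.length) : List Bool :=
  bitOracleL ν (fun v => if v = qVertex ν M x τ i then w i else none) (stepQuery M x τ i)

/-- The tuples predicting exactly the recorded answers. [folklore] -/
def GoodTuple (w : Fin τ.length → Atom d) : Prop := ∀ i : Fin τ.length, τ[(i : ℕ)] = predicted ν M x τ w i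

/-- The σ-free shape condition of a tuple: `some` exactly at the leaf queries. [folklore] -/
def ShapeOK (w : Fin τ.length → Atom d) : Prop := ∀ i : Fin τ.length, depth (qVertex ν M x τ i) = d ↔ (w i).isSome = true

/-- The constraint list a tuple imposes on the first permutation. [folklore] -/
def pairs₁ (w : Fin τ.length → Atom d) : List (Fin (2 ^ d) × Fin (2 ^ d)) :=
  (List.finRange τ.length).flatMap fun i : Fin τ.length => (atomPairs (qVertex ν M x τ i) (w i)).1

/-- The constraint list a tuple imposes on the second permutation. [folklore] -/
def pairs₂ (w : Fin τ.length → Atom d) : List (Fin (2 ^ d) × Fin (2 ^ d)) :=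
  (List.finRange τ.length).flatMap fun i : Fin τ.length => (atomPairs (qVertex ν M x τ i) (w i)).2

variable {ν M x τ}

/-- **Locality, along the transcript**: the bit oracle answers the `i`-th query as predicted by the atom tuple of its
cycle datum. [folklore] -/
theorem bitOracle_eq_predicted
    (hloc : ∀ (d N : ℕ), 1 ≤ d → ∀ (σ : CycleDatum d) (ν : NamingN d N) (α : Vertex d → Atom d) (q : List Bool),
      α (queryVertex ν q) = atomOf σ (queryVertex ν q) → bitOracleL ν α q = bitOracle σ ν q)
    (hd : 1 ≤ d) (σ : CycleDatum d) (i : Fin τ.length) :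
    bitOracle σ ν (stepQuery M x τ i) = predicted ν M x τ (atomTuple ν M x τ σ) i := by
  symm
  apply hloc d N hd σ ν
  simp [atomTuple, qVertex]

/-- **Consistency is a property of the atom tuple**: along a transcript whose proper prefixes ask queries, the bit oracle
of `(σ, ν)` is consistent iff the atom tuple of `σ` is good. [folklore] -/
theorem consistent_iff_goodTuple
    (hloc : ∀ (d N : ℕ), 1 ≤ d → ∀ (σ : CycleDatum d) (ν : NamingN d N) (α : Vertex d → Atom d) (q : List Bool),
      α (queryVertex ν q) = atomOf σ (queryVertex ν q) → bitOracleL ν α q = bitOracle σ ν q)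
    (hd : 1 ≤ d) (hq : ∀ i, i < τ.length → ∃ q, M.step x (τ.take i) = Sum.inl q) (σ : CycleDatum d) :
    M.Consistent x τ (bitOracle σ ν) ↔ GoodTuple ν M x τ (atomTuple ν M x τ σ) := by
  rw [consistent_iff_forall M x τ _ hq]
  simp only [GoodTuple, bitOracle_eq_predicted hloc hd]

/-- **Fibres of the atom tuple are shape ∧ cylinder ∧ cylinder.** [folklore] -/
theorem atomTuple_eq_iff
    (hatom : ∀ (d : ℕ) (σ : CycleDatum d) (v : Vertex d) (α : Atom d),
      atomOf σ v = α ↔ ((depth v = d ↔ α.isSome = true) ∧ Cyl (atomPairs v α).1 σ.1 ∧ Cyl (atomPairs v α).2 σ.2))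
    (σ : CycleDatum d) (w : Fin τ.length → Atom d) :
    atomTuple ν M x τ σ = w ↔
      ShapeOK ν M x τ w ∧ Cyl (pairs₁ ν M x τ w) σ.1 ∧ Cyl (pairs₂ ν M x τ w) σ.2 := by
  constructor
  · intro h
    have hi : ∀ i : Fin τ.length, atomOf σ (qVertex ν M x τ i) = w i := fun i => congrFun h i
    refine ⟨fun i => ((hatom d σ _ _).1 (hi i)).1, fun p hp => ?_, fun p hp => ?_⟩
    · rw [pairs₁, List.mem_flatMap] at hp
      obtain ⟨i, -, hp⟩ := hp
      exact ((hatom d σ _ _).1 (hi i)).2.1 p hp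
    · rw [pairs₂, List.mem_flatMap] at hp
      obtain ⟨i, -, hp⟩ := hp
      exact ((hatom d σ _ _).1 (hi i)).2.2 p hp
  · rintro ⟨hs, h₁, h₂⟩
    funext i
    apply (hatom d σ _ _).2
    refine ⟨hs i, fun p hp => h₁ p ?_, fun p hp => h₂ p ?_⟩
    · rw [pairs₁, List.mem_flatMap]
      exact ⟨i, List.mem_finRange i, hp⟩
    · rw [pairs₂, List.mem_flatMap]
      exact ⟨i, List.mem_finRange i, hp⟩

/-- An atom imposes at most two constraints on each permutation. [folklore] -/
theorem length_atomPairs_le (v : Vertex d) (α : Atom d) :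
    (atomPairs v α).1.length ≤ 2 ∧ (atomPairs v α).2.length ≤ 2 := by
  unfold atomPairs
  rcases α with _ | ⟨k, c₁, c₂⟩
  · simp
  · simp only
    split_ifs <;> simp

/-- The first constraint list of a tuple has at most `2|τ|` entries. [folklore] -/
theorem length_pairs₁_le (w : Fin τ.length → Atom d) : (pairs₁ ν M x τ w).length ≤ 2 * τ.length := by
  rw [pairs₁, List.length_flatMap]
  calc (List.map (fun i : Fin τ.length => (atomPairs (qVertex ν M x τ i) (w i)).1.length) (List.finRange τ.length)).sum
      ≤ (List.map (fun i : Fin τ.length => (atomPairs (qVertex ν M x τ i) (w i)).1.length)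
          (List.finRange τ.length)).length • 2 := by
        refine List.sum_le_card_nsmul _ _ fun l hl => ?_
        rw [List.mem_map] at hl
        obtain ⟨i, -, rfl⟩ := hl
        exact (length_atomPairs_le _ _).1
    _ = 2 * τ.length := by rw [List.length_map, List.length_finRange, smul_eq_mul, mul_comm]

/-- The second constraint list of a tuple has at most `2|τ|` entries. [folklore] -/
theorem length_pairs₂_le (w : Fin τ.length → Atom d) : (pairs₂ ν M x τ w).length ≤ 2 * τ.length := by
  rw [pairs₂, List.length_flatMap]
  calc (List.map (fun i : Fin τ.length => (atomPairs (qVertex ν M x τ i) (w i)).2.length) (List.finRange τ.length)).sum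
      ≤ (List.map (fun i : Fin τ.length => (atomPairs (qVertex ν M x τ i) (w i)).2.length)
          (List.finRange τ.length)).length • 2 := by
        refine List.sum_le_card_nsmul _ _ fun l hl => ?_
        rw [List.mem_map] at hl
        obtain ⟨i, -, rfl⟩ := hl
        exact (length_atomPairs_le _ _).2
    _ = 2 * τ.length := by rw [List.length_map, List.length_finRange, smul_eq_mul, mul_comm]

/-- **The fibrewise ratio**: for every tuple `w`, the fibre "atom tuple `= w`" is, in both worlds, empty (shape mismatch)
or the pair of cylinder events of `w`; so the cylinder ratio hypothesis transfers to the fibres. [folklore] -/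
theorem fibre_ratio {Θ : Type} [Fintype Θ] [Nonempty Θ] (cyc : Θ → CycleDatum d) {ε : ℝ} {t : ℕ}
    (hatom : ∀ (d : ℕ) (σ : CycleDatum d) (v : Vertex d) (α : Atom d),
      atomOf σ v = α ↔ ((depth v = d ↔ α.isSome = true) ∧ Cyl (atomPairs v α).1 σ.1 ∧ Cyl (atomPairs v α).2 σ.2))
    (hratio : ∀ L₁ L₂ : List (Fin (2 ^ d) × Fin (2 ^ d)), L₁.length ≤ 2 * t → L₂.length ≤ 2 * t →
      (1 - ε) * finProb (PMF.uniformOfFintype (CycleDatum d)) (fun σ => Cyl L₁ σ.1 ∧ Cyl L₂ σ.2) ≤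
        finProb (PMF.uniformOfFintype Θ) (fun θ => Cyl L₁ (cyc θ).1 ∧ Cyl L₂ (cyc θ).2))
    (hτ : τ.length ≤ t) (w : Fin τ.length → Atom d) :
    finProb (PMF.uniformOfFintype (CycleDatum d)) (fun σ => atomTuple ν M x τ σ = w) ≤
      finProb (PMF.uniformOfFintype Θ) (fun θ => atomTuple ν M x τ (cyc θ) = w) +
        ε * finProb (PMF.uniformOfFintype (CycleDatum d)) (fun σ => atomTuple ν M x τ σ = w) := by
  by_cases hs : ShapeOK ν M x τ w
  · have eY : finProb (PMF.uniformOfFintype (CycleDatum d)) (fun σ => atomTuple ν M x τ σ = w) =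
        finProb (PMF.uniformOfFintype (CycleDatum d))
          (fun σ => Cyl (pairs₁ ν M x τ w) σ.1 ∧ Cyl (pairs₂ ν M x τ w) σ.2) :=
      finProb_congr _ fun σ => by rw [atomTuple_eq_iff hatom]; exact ⟨fun h => h.2, fun h => ⟨hs, h⟩⟩
    have eX : finProb (PMF.uniformOfFintype Θ) (fun θ => atomTuple ν M x τ (cyc θ) = w) =
        finProb (PMF.uniformOfFintype Θ)
          (fun θ => Cyl (pairs₁ ν M x τ w) (cyc θ).1 ∧ Cyl (pairs₂ ν M x τ w) (cyc θ).2) :=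
      finProb_congr _ fun θ => by rw [atomTuple_eq_iff hatom]; exact ⟨fun h => h.2, fun h => ⟨hs, h⟩⟩
    rw [eY, eX]
    have h := hratio (pairs₁ ν M x τ w) (pairs₂ ν M x τ w) ((length_pairs₁_le w).trans (by omega))
      ((length_pairs₂_le w).trans (by omega))
    linarith
  · have eY : finProb (PMF.uniformOfFintype (CycleDatum d)) (fun σ => atomTuple ν M x τ σ = w) = 0 := by
      rw [finProb_congr _ (E' := fun _ => False) fun σ =>
        ⟨fun h => hs ((atomTuple_eq_iff hatom σ w).1 h).1, False.elim⟩]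
      exact finProb_false _
    have eX : finProb (PMF.uniformOfFintype Θ) (fun θ => atomTuple ν M x τ (cyc θ) = w) = 0 := by
      rw [finProb_congr _ (E' := fun _ => False) fun θ =>
        ⟨fun h => hs ((atomTuple_eq_iff hatom (cyc θ) w).1 h).1, False.elim⟩]
      exact finProb_false _
    rw [eY, eX]
    simp

/-- **The ratio hypothesis of the coefficient-H bound, from the fibrewise ratios**: summed over the good tuples.
[cite: Patarin2009, Thm. 3 (p. 329) and App. B] -/
theorem goodTuple_ratio {Θ : Type} [Fintype Θ] [Nonempty Θ] (cyc : Θ → CycleDatum d) {ε : ℝ} {t : ℕ}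
    (hatom : ∀ (d : ℕ) (σ : CycleDatum d) (v : Vertex d) (α : Atom d),
      atomOf σ v = α ↔ ((depth v = d ↔ α.isSome = true) ∧ Cyl (atomPairs v α).1 σ.1 ∧ Cyl (atomPairs v α).2 σ.2))
    (hratio : ∀ L₁ L₂ : List (Fin (2 ^ d) × Fin (2 ^ d)), L₁.length ≤ 2 * t → L₂.length ≤ 2 * t →
      (1 - ε) * finProb (PMF.uniformOfFintype (CycleDatum d)) (fun σ => Cyl L₁ σ.1 ∧ Cyl L₂ σ.2) ≤
        finProb (PMF.uniformOfFintype Θ) (fun θ => Cyl L₁ (cyc θ).1 ∧ Cyl L₂ (cyc θ).2))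
    (hτ : τ.length ≤ t) :
    finProb (PMF.uniformOfFintype (CycleDatum d)) (fun σ => GoodTuple ν M x τ (atomTuple ν M x τ σ)) ≤
      finProb (PMF.uniformOfFintype Θ) (fun θ => GoodTuple ν M x τ (atomTuple ν M x τ (cyc θ))) +
        ε * finProb (PMF.uniformOfFintype (CycleDatum d)) (fun σ => GoodTuple ν M x τ (atomTuple ν M x τ σ)) := by
  classical
  rw [finProb_comp_eq_sum_filter _ (atomTuple ν M x τ) (GoodTuple ν M x τ),
    finProb_comp_eq_sum_filter _ (fun θ => atomTuple ν M x τ (cyc θ)) (GoodTuple ν M x τ),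
    Finset.mul_sum, ← Finset.sum_add_distrib]
  exact Finset.sum_le_sum fun w _ => fibre_ratio cyc hatom hratio hτ w

end Atoms

/-! ## The registered stub -/

open Classical in
/-- **Stub `stub_hcoeffCycle`** (Patarin's coefficient-H bound on the bit-oracle game, along atoms): for any finite key
space `Θ` rendered as cycle data by `cyc`, if every pair of cylinder events of lengths `≤ 2t` has
`Pr_Θ ≥ (1 − ε)·Pr_{uniform σ}`, then for every naming `ν`, every `t`-round bit-oracle walker succeeds (outputs a string
with `name(EXIT)` as a prefix) against `(cyc θ, ν)` with probability at most its success probability against `(σ, ν)`,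
`σ` uniform, plus `ε`: by `stub_locality` the consistency event of a transcript is a disjoint union, over atom tuples, of
(shape ∧ cylinder ∧ cylinder) events with `≤ 2` constraints per permutation per query, so the ratio hypothesis of
`OracleAlg.hcoeff_abs_le` holds with no bad transcripts. [cite: Patarin2009, Thm. 3 (p. 329) and App. B (pp. 343–344)] -/
theorem stub_hcoeffCycle : ∀ (d N t : ℕ), 1 ≤ d →
    ((∀ (d N : ℕ), 1 ≤ d → ∀ (σ : CycleDatum d) (ν : NamingN d N) (α : Vertex d → Atom d) (q : List Bool),
        α (queryVertex ν q) = atomOf σ (queryVertex ν q) → bitOracleL ν α q = bitOracle σ ν q) ∧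
      (∀ (d : ℕ) (σ : CycleDatum d) (v : Vertex d) (α : Atom d),
        atomOf σ v = α ↔
          ((depth v = d ↔ α.isSome = true) ∧ Cyl (atomPairs v α).1 σ.1 ∧ Cyl (atomPairs v α).2 σ.2))) →
    ∀ (Θ : Type) [Fintype Θ] [Nonempty Θ] (cyc : Θ → CycleDatum d) (ε : ℝ), 0 ≤ ε →
      (∀ L₁ L₂ : List (Fin (2 ^ d) × Fin (2 ^ d)), L₁.length ≤ 2 * t → L₂.length ≤ 2 * t →
        (1 - ε) * finProb (PMF.uniformOfFintype (CycleDatum d)) (fun σ => Cyl L₁ σ.1 ∧ Cyl L₂ σ.2) ≤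
          finProb (PMF.uniformOfFintype Θ) (fun θ => Cyl L₁ (cyc θ).1 ∧ Cyl L₂ (cyc θ).2)) →
      ∀ (ν : NamingN d N) (M : OracleAlg (List Bool)) (x : List Bool),
        ((Finset.univ.filter fun θ : Θ => BitSuccess M x t (cyc θ) ν).card : ℝ) / Fintype.card Θ ≤
          ((Finset.univ.filter fun σ : CycleDatum d => BitSuccess M x t σ ν).card : ℝ) /
              Fintype.card (CycleDatum d) + ε := by
  intro d N t hd hC Θ _ _ cyc ε hε hratio ν M x
  classical
  obtain ⟨hloc, hatom⟩ := hC
  -- the input handed to the walker and the success property of the answer transcript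
  set x' : List Bool := x ++ List.ofFn (ν (entrance d)) with hx'
  let Ps : List (List Bool) → Prop := fun τ => ∃ y, M.finish x' t τ = some y ∧ List.ofFn (ν (GluedTrees.exit d)) <+: y
  have hS : ∀ σ : CycleDatum d, BitSuccess M x t σ ν ↔ Ps (M.answers (bitOracle σ ν) t x') := by
    intro σ
    simp only [BitSuccess, Ps, OracleAlg.run_eq_finish_answers, hx']
  -- Patarin's two-world bound with no bad transcripts
  have hbad : finProb (PMF.uniformOfFintype (CycleDatum d))
      (fun σ => ¬ (fun _ : List (List Bool) => True) (M.answers (bitOracle σ ν) t x')) ≤ 0 := by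
    rw [finProb_eq_sum]
    simp
  have hrat : ∀ σ₀ : CycleDatum d, (fun _ : List (List Bool) => True) (M.answers (bitOracle σ₀ ν) t x') →
      finProb (PMF.uniformOfFintype (CycleDatum d))
          (fun σ => M.Consistent x' (M.answers (bitOracle σ₀ ν) t x') (bitOracle σ ν)) ≤
        finProb (PMF.uniformOfFintype Θ)
            (fun θ => M.Consistent x' (M.answers (bitOracle σ₀ ν) t x') (bitOracle (cyc θ) ν)) +
          ε * finProb (PMF.uniformOfFintype (CycleDatum d))
            (fun σ => M.Consistent x' (M.answers (bitOracle σ₀ ν) t x') (bitOracle σ ν)) := by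
    intro σ₀ _
    set τ := M.answers (bitOracle σ₀ ν) t x' with hτdef
    have hq : ∀ i, i < τ.length → ∃ q, M.step x' (τ.take i) = Sum.inl q := fun i hi =>
      M.exists_step_take_answers (bitOracle σ₀ ν) t x' hi
    have hτ : τ.length ≤ t := M.length_answers_le _ _ _
    have eY : finProb (PMF.uniformOfFintype (CycleDatum d)) (fun σ => M.Consistent x' τ (bitOracle σ ν)) =
        finProb (PMF.uniformOfFintype (CycleDatum d)) (fun σ => GoodTuple ν M x' τ (atomTuple ν M x' τ σ)) :=
      finProb_congr _ fun σ => consistent_iff_goodTuple hloc hd hq σ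
    have eX : finProb (PMF.uniformOfFintype Θ) (fun θ => M.Consistent x' τ (bitOracle (cyc θ) ν)) =
        finProb (PMF.uniformOfFintype Θ) (fun θ => GoodTuple ν M x' τ (atomTuple ν M x' τ (cyc θ))) :=
      finProb_congr _ fun θ => consistent_iff_goodTuple hloc hd hq (cyc θ)
    rw [eY, eX]
    exact goodTuple_ratio cyc hatom hratio hτ
  have habs := M.hcoeff_abs_le t x' (PMF.uniformOfFintype Θ) (fun θ => bitOracle (cyc θ) ν)
    (PMF.uniformOfFintype (CycleDatum d)) (fun σ => bitOracle σ ν) Ps (fun _ => True) hε hrat hbad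
  have hle : finProb (PMF.uniformOfFintype Θ) (fun θ => Ps (M.answers (bitOracle (cyc θ) ν) t x')) ≤
      finProb (PMF.uniformOfFintype (CycleDatum d)) (fun σ => Ps (M.answers (bitOracle σ ν) t x')) + ε := by
    have h := (abs_sub_le_iff.1 habs).1
    linarith
  rw [LubyRackoff.finProb_uniform, LubyRackoff.finProb_uniform] at hle
  have e1 : (Finset.univ.filter fun θ : Θ => Ps (M.answers (bitOracle (cyc θ) ν) t x')) =
      Finset.univ.filter fun θ : Θ => BitSuccess M x t (cyc θ) ν :=
    Finset.filter_congr fun θ _ => (hS (cyc θ)).symm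
  have e2 : (Finset.univ.filter fun σ : CycleDatum d => Ps (M.answers (bitOracle σ ν) t x')) =
      Finset.univ.filter fun σ : CycleDatum d => BitSuccess M x t σ ν :=
    Finset.filter_congr fun σ _ => (hS σ).symm
  rw [e1, e2] at hle
  convert hle using 2

end Summit.QuantumAdvantage.QuantumAdvantage.Theorems.WbwObfuscatedGluedTrees.KnowledgeOfWalk.RealIdeal

end
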